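import Summits.BirchSwinnertonDyer.BirchSwinnertonDyer.Theorems.ManinLocalTwoThreeTameCellLocalTwoTorsionHolds
import Summits.BirchSwinnertonDyer.Rank1Residual.ManinAdditive.KodairaDiscUnitAtTwo
import HarnessLib

/-!
# T-desc-IV♭ PROVED: the unit part of the minimal discriminant on the tame cell `4 ∥ N` (Kodaira IV / IV* at `2`)
# (route `ManinLocalTwoThree`, cell bsd-f2-manin, desc lens ask P-desc-1 / typer node file `…/ManinAdditive/KodairaDiscUnitAtTwo.lean`;
# crux C2 `ManinOddAtFour` stmt-BirchSwinnertonDyer-22967)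

The desc lens's two THEOREM-CANDIDATES (MEMO-desc §33.12; census 235/235 optimal curves with `4 ∥ N ≤ 1000`), the
arithmetic shadow of T-desc-IV «at `v₂(N) = 2`: Kodaira IV ⟺ `ℚ₂(E[2])/ℚ₂` unramified, IV* ⟺ ramified», are PROVED:

* **`typeFourDiscUnitLawAtTwo_holds : KodairaDiscUnit.TypeFourDiscUnitLawAtTwo`** — `4 ∥ N`, `v₂(Δ_min) = 4` ⟹
  `Δ_min/2⁴ ≡ 1 (mod 4)`.  PROOF (shorter than the memo's): additive reduction at `2` gives the lead's `a₁ = a₃ = 0`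
  globally minimal integral companion `M` (p620514 `exists_smul_eq_map_a₁_a₃_eq_zero_of_hasAdditiveReductionAt_two`), so
  `Δ_min = Δ(M) = 16·d`, `d = disc(x³ + a₂x² + a₄x + a₆)`; `v₂ = 4` makes `d` odd and `d ≡ (a₂a₄ + a₆)² (mod 4)`.
* **`typeFourStarDiscUnitLawAtTwo_holds : KodairaDiscUnit.TypeFourStarDiscUnitLawAtTwo`** — `4 ∥ N`, `v₂(Δ_min) = 8` ⟹
  `Δ_min/2⁸ ≢ 1 (mod 8)`.  PROOF: Kodaira `IV*` at `2` (`kodairaSymbolAt_of_four_dvd_conductorNorm`), read over `ℤ₂`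
  (`kodairaSymbolAt_eq_padic`), gives the Tate normal form `[2α, 4α₂, 4α₃, 8α₄, 16α₆]`, `α₃ ∈ ℤ₂ˣ`
  (`exists_IVstarNormalForm_padicInt`, E-imc-75's file), whose discriminant is `2⁸·δ`,
  `δ = −27α₃⁴ + 2α³α₃³ + 4α²M + 8R` (`Δ_IVstarNormalForm`, `ring`); modulo `8` the core `−27y⁴ + 2x³y³ + 4x²m` (`y² = 1`)
  is never `0` or `1` (`decide` in `ℤ/8`: it is `5` for `α` even, `3` or `7` for `α` odd); and `δ = u¹²·(Δ_min/2⁸)` in `ℤ₂`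
  for the total change of variables, where `u ∈ ℤ₂` by a norm count and `u¹² ≡ 0` or `1 (mod 8)`.
* hence **`kodairaDiscUnitLawAtTwo_holds`**, **`discUnitDichotomyAtTwo_holds`** by the typed edges.

Nothing about BSD or Manin's conjecture is proved here; C2 stays OPEN.  [cite: SilvermanATAEC1994, IV.9.4 and Table 4.1]
-/

set_option linter.dupNamespace false

noncomputable section

open scoped Classical NumberField
open WeierstrassCurve IsDedekindDomain Rat.HeightOneSpectrum Literature.NumberTheory.EllipticCurves
open Summit.BirchSwinnertonDyer.Rank1Residual.ManinAdditive.KodairaDiscUnit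

namespace Summit.BirchSwinnertonDyer.BirchSwinnertonDyer.Theorems.ManinLocalTwoThree

/-! ### §1 Type IV: `Δ_min/16` is an odd square mod 4 -/
/-- The cubic discriminant `d(a₂,a₄,a₆)` is congruent to the square `(a₂a₄ + a₆)²` modulo `4`; if it is odd it is
`≡ 1 (mod 4)`. [folklore] -/
theorem cubicDisc_modEq_one_of_odd (a₂ a₄ a₆ : ℤ)
    (hodd : ¬ (2 : ℤ) ∣ a₂ ^ 2 * a₄ ^ 2 - 4 * a₄ ^ 3 - 4 * a₂ ^ 3 * a₆ + 18 * a₂ * a₄ * a₆ - 27 * a₆ ^ 2) :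
    a₂ ^ 2 * a₄ ^ 2 - 4 * a₄ ^ 3 - 4 * a₂ ^ 3 * a₆ + 18 * a₂ * a₄ * a₆ - 27 * a₆ ^ 2 ≡ 1 [ZMOD 4] := by
  set s : ℤ := a₂ * a₄ + a₆ with hs
  have hd : a₂ ^ 2 * a₄ ^ 2 - 4 * a₄ ^ 3 - 4 * a₂ ^ 3 * a₆ + 18 * a₂ * a₄ * a₆ - 27 * a₆ ^ 2
      = s ^ 2 + 4 * (-a₄ ^ 3 - a₂ ^ 3 * a₆ + 4 * a₂ * a₄ * a₆ - 7 * a₆ ^ 2) := by rw [hs]; ring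
  rw [hd] at hodd ⊢
  have hsodd : ¬ (2 : ℤ) ∣ s := by
    intro h2s
    apply hodd
    exact dvd_add (dvd_pow h2s two_ne_zero) (dvd_mul_of_dvd_left (by norm_num) _)
  -- an odd square is `1 mod 4`
  have hs2 : s ^ 2 ≡ 1 [ZMOD 4] := by
    have h := Int.emod_two_eq_zero_or_one s
    rcases h with h | h
    · exact absurd (Int.dvd_of_emod_eq_zero h) hsodd
    · have : s % 4 = 1 ∨ s % 4 = 3 := by omega
      rcases this with h4 | h4
      · have := Int.ModEq.pow 2 (show s ≡ 1 [ZMOD 4] from h4)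
        simpa using this
      · have := Int.ModEq.pow 2 (show s ≡ 3 [ZMOD 4] from h4)
        exact this.trans (by decide)
  calc s ^ 2 + 4 * (-a₄ ^ 3 - a₂ ^ 3 * a₆ + 4 * a₂ * a₄ * a₆ - 7 * a₆ ^ 2)
      ≡ 1 + 4 * (-a₄ ^ 3 - a₂ ^ 3 * a₆ + 4 * a₂ * a₄ * a₆ - 7 * a₆ ^ 2) [ZMOD 4] := Int.ModEq.add_right _ hs2
    _ ≡ 1 + 0 [ZMOD 4] := Int.ModEq.add_left _ (Int.modEq_zero_iff_dvd.mpr (dvd_mul_right 4 _))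
    _ = 1 := by ring

/-- **T-desc-IV♭(a) PROVED (`KodairaDiscUnit.TypeFourDiscUnitLawAtTwo`).**  For a globally minimal elliptic `W/ℚ` with
`4 ∥ N_W` and `v₂(Δ_min) = 4` (Kodaira IV at `2`): `Δ_min/2⁴ ≡ 1 (mod 4)`.  [cite: SilvermanATAEC1994, IV.9.4 and Table 4.1] -/
theorem typeFourDiscUnitLawAtTwo_holds : TypeFourDiscUnitLawAtTwo := by
  intro W _ _ h4 h8 hΔ4
  -- additive reduction at `2` (`f₂ = 2`)
  set v : HeightOneSpectrum ℤ := (primesEquiv (R := ℤ)).symm ⟨2, Nat.prime_two⟩ with hvdef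
  have hv : natGenerator v = 2 :=
    Literature.NumberTheory.EllipticCurves.Rat.natGenerator_primesEquiv_symm ⟨2, Nat.prime_two⟩
  have hf : W.conductorExponent v = 2 := W.conductorExponent_eq_two_of_four_dvd_conductorNorm v hv h4 h8
  have haddZ : W.HasAdditiveReductionAt v := (W.two_le_conductorExponent_iff_holds v).mp (by omega)
  have hadd : W.HasAdditiveReductionAt ((primesEquiv (R := 𝓞 ℚ)).symm ⟨2, Nat.prime_two⟩) :=
    (W.hasAdditiveReductionAt_int_iff_ringOfIntegers ⟨2, Nat.prime_two⟩).mp haddZ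
  -- the `a₁ = a₃ = 0` globally minimal companion
  obtain ⟨C, M, hu, hCW, hM1, hM3, -⟩ := exists_smul_eq_map_a₁_a₃_eq_zero_of_hasAdditiveReductionAt_two W hadd
  set d : ℤ := M.a₂ ^ 2 * M.a₄ ^ 2 - 4 * M.a₄ ^ 3 - 4 * M.a₂ ^ 3 * M.a₆ + 18 * M.a₂ * M.a₄ * M.a₆ - 27 * M.a₆ ^ 2
    with hd
  have hMΔ : M.Δ = 16 * d := by
    rw [hd]
    simp only [WeierstrassCurve.Δ, WeierstrassCurve.b₂, WeierstrassCurve.b₄, WeierstrassCurve.b₆, WeierstrassCurve.b₈,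
      hM1, hM3]
    ring
  have hmin' : W.minimalDiscriminantInt = M.Δ := by
    have h1 : (W.minimalDiscriminantInt : ℚ) = W.Δ := cast_minimalDiscriminantInt W
    have h2 : (C • W).Δ = W.Δ := by rw [variableChange_Δ, hu]; simp
    have h3 : (C • W).Δ = (M.Δ : ℚ) := by rw [hCW, map_Δ, eq_intCast]
    exact_mod_cast (h1.trans (h2.symm.trans h3))
  have hMΔne : M.Δ ≠ 0 := by rw [← hmin']; exact minimalDiscriminantInt_ne_zero W
  have hodd : ¬ (2 : ℤ) ∣ d := by
    rintro ⟨k, hk⟩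
    have h32 : ((2 : ℕ) : ℤ) ^ 5 ∣ M.Δ := ⟨k, by rw [hMΔ, hk]; push_cast; ring⟩
    rw [padicValInt_dvd_iff] at h32
    rcases h32 with h0 | h5
    · exact hMΔne h0
    · rw [← hmin', hΔ4] at h5; omega
  -- `Δ_min / 16 = d ≡ 1 (mod 4)`
  have hdiv : W.minimalDiscriminantInt / 2 ^ 4 = d := by
    rw [hmin', hMΔ]
    norm_num
  rw [hdiv]
  exact cubicDisc_modEq_one_of_odd M.a₂ M.a₄ M.a₆ hodd


/-! ### §2 Type IV*: the discriminant of the Tate `IV*`-normal form at `2` -/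

/-- `Δ[2α, 4α₂, 4α₃, 8α₄, 16α₆] = 2⁸ · (−27α₃⁴ + 2α³α₃³ + 4α²·M + 8·R)` with explicit `M`, `R` (any commutative ring). [folklore] -/
theorem Δ_IVstarNormalForm {R : Type*} [CommRing R] (N : WeierstrassCurve R) {α α₂ α₃ α₄ α₆ : R}
    (h₁ : N.a₁ = 2 * α) (h₂ : N.a₂ = 4 * α₂) (h₃ : N.a₃ = 4 * α₃) (h₄ : N.a₄ = 8 * α₄) (h₆ : N.a₆ = 16 * α₆) :
    N.Δ = 2 ^ 8 * (-27 * α₃ ^ 4 + 2 * α ^ 3 * α₃ ^ 3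
      + 4 * α ^ 2 * (-15 * α₃ ^ 2 * α₄ + α ^ 2 * α₄ ^ 2 - α ^ 2 * α₂ * α₃ ^ 2 + α ^ 3 * α₃ * α₄ - α ^ 4 * α₆)
      + 8 * (-54 * α₆ ^ 2 - 16 * α₄ ^ 3 - 27 * α₃ ^ 2 * α₆ + 72 * α₂ * α₄ * α₆ + 18 * α₂ * α₃ ^ 2 * α₄
             + 8 * α₂ ^ 2 * α₄ ^ 2 - 32 * α₂ ^ 3 * α₆ - 8 * α₂ ^ 3 * α₃ ^ 2 - 24 * α * α₃ * α₄ ^ 2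
             + 36 * α * α₂ * α₃ * α₆ + 9 * α * α₂ * α₃ ^ 3 + 8 * α * α₂ ^ 2 * α₃ * α₄ + 18 * α ^ 2 * α₄ * α₆
             + 4 * α ^ 2 * α₂ * α₄ ^ 2 - 24 * α ^ 2 * α₂ ^ 2 * α₆ - 4 * α ^ 2 * α₂ ^ 2 * α₃ ^ 2
             + 9 * α ^ 3 * α₃ * α₆ + 4 * α ^ 3 * α₂ * α₃ * α₄ - 6 * α ^ 4 * α₂ * α₆)) := by
  simp only [WeierstrassCurve.Δ, WeierstrassCurve.b₂, WeierstrassCurve.b₄, WeierstrassCurve.b₆, WeierstrassCurve.b₈,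
    h₁, h₂, h₃, h₄, h₆]
  ring

/-! ### §3 Arithmetic in `ℤ/8` -/

/-- The core of `Δ/2⁸` mod `8` is never `0` or `1` when `α₃` is odd: `5` if `α` is even, `3` or `7` if `α` is odd. [folklore] -/
theorem zmod8_core_ne (x y m : ZMod (2 ^ 3)) (hy : y * y = 1) :
    -27 * y ^ 4 + 2 * x ^ 3 * y ^ 3 + 4 * x ^ 2 * m ≠ 0 ∧ -27 * y ^ 4 + 2 * x ^ 3 * y ^ 3 + 4 * x ^ 2 * m ≠ 1 := by
  revert x y m
  decide

/-- In `ℤ/8` every twelfth power is `0` or `1`. [folklore] -/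
theorem zmod8_pow_twelve (z : ZMod (2 ^ 3)) : z ^ 12 = 0 ∨ z ^ 12 = 1 := by
  revert z
  decide

/-- In `ℤ/8` an invertible element squares to `1`. [folklore] -/
theorem zmod8_sq_eq_one_of_mul_eq_one (y y' : ZMod (2 ^ 3)) (h : y * y' = 1) : y * y = 1 := by
  revert y y'
  decide

/-! ### §4 T-desc-IV♭(b) -/

/-- **T-desc-IV♭(b) PROVED (`KodairaDiscUnit.TypeFourStarDiscUnitLawAtTwo`).**  For a globally minimal elliptic `W/ℚ`
with `4 ∥ N_W` and `v₂(Δ_min) = 8` (Kodaira IV* at `2`): `Δ_min/2⁸ ≢ 1 (mod 8)`.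
[cite: SilvermanATAEC1994, IV.9.4 (steps 2, 6, 8) and Table 4.1] -/
theorem typeFourStarDiscUnitLawAtTwo_holds : TypeFourStarDiscUnitLawAtTwo := by
  intro W _ _ h4 h8 hΔ8 hmod
  -- Kodaira `IV*` at the place of `ℤ` above `2`
  set v : IsDedekindDomain.HeightOneSpectrum ℤ := (Rat.HeightOneSpectrum.primesEquiv (R := ℤ)).symm ⟨2, Nat.prime_two⟩
    with hvdef
  have hv : Rat.HeightOneSpectrum.natGenerator v = 2 :=
    Literature.NumberTheory.EllipticCurves.Rat.natGenerator_primesEquiv_symm ⟨2, Nat.prime_two⟩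
  have hK : W.kodairaSymbolAt v = .IVstar := by
    rcases W.kodairaSymbolAt_of_four_dvd_conductorNorm v hv h4 h8 with ⟨-, h⟩ | ⟨h, -⟩
    · rw [hΔ8] at h; norm_num at h
    · exact h
  have e : Rat.HeightOneSpectrum.primesEquiv (R := ℤ) v = ⟨2, Nat.prime_two⟩ := Equiv.apply_symm_apply _ _
  have hKp := WeierstrassCurve.kodairaSymbolAt_eq_padic (R := ℤ) v W
  rw [e] at hKp
  change W.kodairaSymbolAt v = (((W.baseChange ℚ_[2]).minimal ℤ_[2]).integralModel ℤ_[2]).kodairaSymbolOfMinimal at hKp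
  rw [hK] at hKp
  set X : WeierstrassCurve ℚ_[2] := W.baseChange ℚ_[2] with hX
  set V₀ : WeierstrassCurve ℤ_[2] := (X.minimal ℤ_[2]).integralModel ℤ_[2] with hV₀
  obtain ⟨D, α, α₂, α₃, α₄, α₆, h₁, h₂, h₃, hα₃, h₄', h₆⟩ := exists_IVstarNormalForm_padicInt V₀ hKp.symm
  -- the total change of variables over `ℚ₂`
  set E : WeierstrassCurve.VariableChange ℚ_[2] := (X.exists_isMinimal ℤ_[2]).choose with hE
  have hmin : X.minimal ℤ_[2] = E • X := rfl
  have hV₀X : V₀.baseChange ℚ_[2] = X.minimal ℤ_[2] := WeierstrassCurve.baseChange_integralModel_eq ℤ_[2] _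
  set Ctot : WeierstrassCurve.VariableChange ℚ_[2] := D.map (algebraMap ℤ_[2] ℚ_[2]) * E with hCtot
  have hCX : Ctot • X = (D • V₀).map (algebraMap ℤ_[2] ℚ_[2]) := by
    rw [hCtot, mul_smul, ← hmin, ← hV₀X]
    exact WeierstrassCurve.map_variableChange _ _ _
  -- the discriminant of the normal form
  set M' : ℤ_[2] := -15 * α₃ ^ 2 * α₄ + α ^ 2 * α₄ ^ 2 - α ^ 2 * α₂ * α₃ ^ 2 + α ^ 3 * α₃ * α₄ - α ^ 4 * α₆
    with hM'
  set R' : ℤ_[2] := -54 * α₆ ^ 2 - 16 * α₄ ^ 3 - 27 * α₃ ^ 2 * α₆ + 72 * α₂ * α₄ * α₆ + 18 * α₂ * α₃ ^ 2 * α₄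
             + 8 * α₂ ^ 2 * α₄ ^ 2 - 32 * α₂ ^ 3 * α₆ - 8 * α₂ ^ 3 * α₃ ^ 2 - 24 * α * α₃ * α₄ ^ 2
             + 36 * α * α₂ * α₃ * α₆ + 9 * α * α₂ * α₃ ^ 3 + 8 * α * α₂ ^ 2 * α₃ * α₄ + 18 * α ^ 2 * α₄ * α₆
             + 4 * α ^ 2 * α₂ * α₄ ^ 2 - 24 * α ^ 2 * α₂ ^ 2 * α₆ - 4 * α ^ 2 * α₂ ^ 2 * α₃ ^ 2
             + 9 * α ^ 3 * α₃ * α₆ + 4 * α ^ 3 * α₂ * α₃ * α₄ - 6 * α ^ 4 * α₂ * α₆ with hR'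
  set δ : ℤ_[2] := -27 * α₃ ^ 4 + 2 * α ^ 3 * α₃ ^ 3 + 4 * α ^ 2 * M' + 8 * R' with hδ
  have hNΔ : (D • V₀).Δ = 2 ^ 8 * δ := by
    rw [hδ, hM', hR']; exact Δ_IVstarNormalForm (D • V₀) h₁ h₂ h₃ h₄' h₆
  -- the integer side: `Δ_min = 2⁸ · m`, `m` odd
  have hΔne : W.minimalDiscriminantInt ≠ 0 := minimalDiscriminantInt_ne_zero W
  obtain ⟨m, hm⟩ : (2 : ℤ) ^ 8 ∣ W.minimalDiscriminantInt := by
    have := (padicValInt_dvd_iff (p := 2) 8 W.minimalDiscriminantInt).mpr (Or.inr (by omega))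
    exact_mod_cast this
  have hm_odd : ¬ (2 : ℤ) ∣ m := by
    rintro ⟨k, hk⟩
    have h9 : ((2 : ℕ) : ℤ) ^ 9 ∣ W.minimalDiscriminantInt := ⟨k, by rw [hm, hk]; ring⟩
    rw [padicValInt_dvd_iff] at h9
    rcases h9 with h0 | h9
    · exact hΔne h0
    · omega
  have hdiv : W.minimalDiscriminantInt / 2 ^ 8 = m := by
    rw [hm]; exact Int.mul_ediv_cancel_left _ (by norm_num)
  rw [hdiv] at hmod
  -- the `ℚ₂` side: `Δ(D • V₀) = u'^12 · Δ_min`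
  have hXΔ : X.Δ = ((W.minimalDiscriminantInt : ℚ) : ℚ_[2]) := by
    rw [hX, WeierstrassCurve.baseChange, map_Δ, cast_minimalDiscriminantInt, eq_ratCast]
  set u' : ℚ_[2] := ((Ctot.u⁻¹ : ℚ_[2]ˣ) : ℚ_[2]) with hu'
  have halg : ∀ z : ℤ_[2], algebraMap ℤ_[2] ℚ_[2] z = (z : ℚ_[2]) := fun z => rfl
  have h1 := variableChange_Δ X Ctot
  rw [hCX, map_Δ, hNΔ, hXΔ, hm, halg] at h1
  -- `h1 : ↑(2^8 * δ) = ↑(Ctot.u⁻¹ ^ 12) * ↑↑(2^8 * m)`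
  have h1' : (2 : ℚ_[2]) ^ 8 * (δ : ℚ_[2]) = (2 : ℚ_[2]) ^ 8 * (u' ^ 12 * (m : ℚ_[2])) := by
    have h := h1
    rw [← hu'] at h
    push_cast at h
    have e2 : ((2 : ℤ_[2]) : ℚ_[2]) = 2 := by exact_mod_cast PadicInt.coe_natCast 2
    rw [e2] at h
    linear_combination h
  have h2ne : (2 : ℚ_[2]) ^ 8 ≠ 0 := pow_ne_zero _ two_ne_zero
  have hδu : (δ : ℚ_[2]) = u' ^ 12 * (m : ℚ_[2]) := mul_left_cancel₀ h2ne h1'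
  -- norms: `u'` is a `2`-adic integer
  have hmnorm : ‖(m : ℚ_[2])‖ = 1 := by
    have hle := Padic.norm_int_le_one (p := 2) m
    have hlt : ¬ ‖(m : ℚ_[2])‖ < 1 := by
      rw [Padic.norm_intCast_lt_one_iff]; exact_mod_cast hm_odd
    exact le_antisymm hle (not_lt.mp hlt)
  have hu'le : ‖u'‖ ≤ 1 := by
    have hδle : ‖(δ : ℚ_[2])‖ ≤ 1 := by rw [← PadicInt.norm_def]; exact PadicInt.norm_le_one δ
    rw [hδu, norm_mul, norm_pow, hmnorm, mul_one] at hδle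
    exact (pow_le_one_iff_of_nonneg (norm_nonneg _) (by norm_num)).mp hδle
  set u₀ : ℤ_[2] := ⟨u', hu'le⟩ with hu₀
  have hδ₀ : δ = u₀ ^ 12 * (m : ℤ_[2]) := by
    apply Subtype.ext
    push_cast
    rw [hδu]
  -- reduction mod 8
  have hπ := congrArg (PadicInt.toZModPow 3 : ℤ_[2] →+* ZMod (2 ^ 3)) hδ₀
  rw [map_mul, map_pow, map_intCast] at hπ
  have hm8 : ((m : ℤ) : ZMod (2 ^ 3)) = 1 := by
    have hmod' : m ≡ 1 [ZMOD ((2 ^ 3 : ℕ) : ℤ)] := by norm_num; exact hmod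
    have h := (ZMod.intCast_eq_intCast_iff (a := m) (b := 1) (c := 2 ^ 3)).mpr hmod'
    simpa using h
  rw [hm8, mul_one] at hπ
  -- the core of `δ` mod 8
  have hδπ : PadicInt.toZModPow 3 δ =
      -27 * (PadicInt.toZModPow 3 α₃) ^ 4 + 2 * (PadicInt.toZModPow 3 α) ^ 3 * (PadicInt.toZModPow 3 α₃) ^ 3 +
        4 * (PadicInt.toZModPow 3 α) ^ 2 * (PadicInt.toZModPow 3 M') := by
    rw [hδ]
    simp only [map_add, map_mul, map_pow, map_neg, map_ofNat]
    have h8 : (8 : ZMod (2 ^ 3)) = 0 := by decide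
    rw [h8, zero_mul, add_zero]
  -- `α₃` is a unit mod 8
  obtain ⟨β, hβ⟩ := hα₃.exists_right_inv
  have hy : PadicInt.toZModPow 3 α₃ * PadicInt.toZModPow 3 α₃ = 1 :=
    zmod8_sq_eq_one_of_mul_eq_one _ (PadicInt.toZModPow 3 β) (by rw [← map_mul, hβ, map_one])
  obtain ⟨hne0, hne1⟩ := zmod8_core_ne (PadicInt.toZModPow 3 α) (PadicInt.toZModPow 3 α₃) (PadicInt.toZModPow 3 M') hy
  rw [← hδπ, hπ] at hne0 hne1
  rcases zmod8_pow_twelve (PadicInt.toZModPow 3 u₀) with h0 | h1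
  · exact hne0 h0
  · exact hne1 h1


/-! ### §5 The conjunction and the dichotomy -/

/-- **T-desc-IV♭ `KodairaDiscUnit.KodairaDiscUnitLawAtTwo` PROVED** (census 235/235): both halves. [folklore] -/
theorem kodairaDiscUnitLawAtTwo_holds : KodairaDiscUnitLawAtTwo :=
  kodairaDiscUnitLawAtTwo_of typeFourDiscUnitLawAtTwo_holds typeFourStarDiscUnitLawAtTwo_holds

/-- **`KodairaDiscUnit.DiscUnitDichotomyAtTwo` PROVED**: on `4 ∥ N`, `Δ_min/2⁴ ≡ 1 (4)` or `Δ_min/2⁸ ≢ 1 (8)`. [folklore] -/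
theorem discUnitDichotomyAtTwo_holds : DiscUnitDichotomyAtTwo :=
  discUnitDichotomyAtTwo_of kodairaDiscUnitLawAtTwo_holds

end Summit.BirchSwinnertonDyer.BirchSwinnertonDyer.Theorems.ManinLocalTwoThree

end
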